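import Mathlib
import Summits.Langlands.Langlands.Theorems.QuadraticWindowHostInducedRepPatchDescend

/-!
# Patching with DESIGNATED control over rational primes — stub `stub_patchDescendRat` of the line
`grs-explicit-descent` (crux `QuadraticWindow.HostInducedRep`, stmt-Langlands-10902), round 2

Round-2 form of the landed `stub_patchDescend` (`QuadraticWindowHostInducedRepPatchDescend.lean`):
the Galois arrow of the line (Goldring–Koskivirta 2019, Thm. 3.5.5, as printed) controls the
representations over the CM members `K` only at places over RATIONAL primes above which everything
is unramified, so the designated control "above the auxiliary place `v₀`" can only be supplied
(i) at DESIGNATABLE places `v₀` (an abstract predicate `Des`, in the line: every place of `F₀` over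
the rational prime of `v₀` is good) and (ii) for members `K` in which every place of `F₀` over the
rational prime of `v₀` splits completely.  The patching lemma survives verbatim: the proved
`∅`-general family `F₀(√-D)`, `D ∈ GoodPrime F₀ M ∅`, contains for every `v₀` a member with
`8 q ∣ D + 1`, `q` the rational prime below `v₀` (`GoodPrime.exists_dvd_split`), in which every place
over `q` splits completely (`isSquare_adicCompletion_neg_natCast`, `ncard_primesOver_sqrtNegField_eq_two`);
the conclusion is control of the patched `R` at every controlled DESIGNATABLE place.  Pure Galois
theory + Dirichlet, proved from the helpers of the round-1 file.

References: C. M. Sorensen, *A patching lemma*, §1 Lemma 2 and Example [Sorensen2020];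
Harris–Taylor, proof of Thm. VII.1.9; Harris–Lan–Taylor–Thorne, proof of Cor. 7.14.
-/

open scoped BigOperators Polynomial Classical
open Filter Set Function Polynomial IsDedekindDomain NumberField
open Literature.NumberTheory.Automorphic Literature.NumberTheory.Automorphic.PatchingFamily
open Literature.NumberTheory.GaloisRepresentations
open Literature.NumberTheory.GaloisRepresentations.QuadraticFamily

set_option linter.dupNamespace false -- project-wide option (lakefile weak.linter.dupNamespace); `Summit.Langlands.Langlands` is the mandated namespace

noncomputable section

namespace Summit.Langlands.Langlands.Theorems.HostInducedRep.GrsExplicitDescent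

section SplitOverPrime

variable {F₀ : Type} [Field F₀] [NumberField F₀]

omit [NumberField F₀] in
/-- If `q ∈ v` and `v'` lies over the same rational prime as `v`, then `q ∈ v'`. [folklore] -/
theorem natCast_mem_of_under_int_eq {v v' : HeightOneSpectrum (𝓞 F₀)} {q : ℕ}
    (hq : ((q : ℕ) : 𝓞 F₀) ∈ v.asIdeal) (h : v'.asIdeal.under ℤ = v.asIdeal.under ℤ) :
    ((q : ℕ) : 𝓞 F₀) ∈ v'.asIdeal := by
  have h1 : (q : ℤ) ∈ v.asIdeal.under ℤ := by
    rw [Ideal.under_def, Ideal.mem_comap, map_natCast]; exact hq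
  rw [← h, Ideal.under_def, Ideal.mem_comap, map_natCast] at h1
  exact h1

/-- **In the member `F₀(√-D)` with `8q ∣ D + 1`, every place of `F₀` containing the rational prime
`q` splits completely**, so the places above it have `e = f = 1`
(`ncard_primesOver_sqrtNegField_eq_two` + `ramificationIdx_inertiaDeg_eq_one_of_ncard`).
[cite: Sorensen2020, §1 Example] -/
theorem split_above_of_dvd {M : ℕ} (i : GoodPrime F₀ M ∅) {q : ℕ} (hq : q.Prime)
    (hqD : 8 * q ∣ i.1 + 1) (v : HeightOneSpectrum (𝓞 F₀)) (hqv : ((q : ℕ) : 𝓞 F₀) ∈ v.asIdeal)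
    (u : HeightOneSpectrum (𝓞 (sqrtNegField F₀ i.1))) (hu : u.under (𝓞 F₀) = v) :
    u.asIdeal.ramificationIdx (𝓞 F₀) = 1 ∧ u.asIdeal.inertiaDeg (𝓞 F₀) = 1 := by
  refine ramificationIdx_inertiaDeg_eq_one_of_ncard v ?_ u hu
  rw [finrank_sqrtNegField]
  exact ncard_primesOver_sqrtNegField_eq_two v hq hqv hqD

end SplitOverPrime

section Compatible

variable {F₀ : Type} [Field F₀] [NumberField F₀] {K : Type} [Field K] [NumberField K]
  [Algebra F₀ K] [IsGalois F₀ K] {ℓ : ℕ} [Fact ℓ.Prime] {m : ℕ}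

/-- **Patch control almost everywhere gives `CompatibleAE` with the datum of a CHOSEN controlled
polynomial** (no uniqueness of controlled polynomials needed): if `Pch v` is controlled wherever
some polynomial is, `E v = roots (Pch v)`, and `r` is patch-controlled at all but finitely many
`u`, then `r` is unramified with characteristic polynomial `frobPoly E v f(u|v)` at all but
finitely many `u` (a controlled characteristic polynomial is the product over its roots,
`eq_prod_roots_of_hasFrobCharpolyAt`). [folklore] -/
theorem compatibleAE_of_ctrl_chosen (h2 : Module.finrank F₀ K = 2)
    {Ctrl : HeightOneSpectrum (𝓞 F₀) → (PadicAlgCl ℓ)[X] → Prop}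
    (hcof : ∀ᶠ v : HeightOneSpectrum (𝓞 F₀) in cofinite, ∃ P, Ctrl v P)
    {Pch : HeightOneSpectrum (𝓞 F₀) → (PadicAlgCl ℓ)[X]}
    (hPch : ∀ v : HeightOneSpectrum (𝓞 F₀), (∃ P, Ctrl v P) → Ctrl v (Pch v))
    {r : FramedGaloisRep K (PadicAlgCl ℓ) m}
    (hr : ∀ᶠ u : HeightOneSpectrum (𝓞 K) in cofinite,
      ∀ P : (PadicAlgCl ℓ)[X], Ctrl (u.under (𝓞 F₀)) P → u.asIdeal.ramificationIdx (𝓞 F₀) = 1 →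
        r.IsUnramifiedAt u ∧ (u.asIdeal.inertiaDeg (𝓞 F₀) = 1 → r.HasFrobCharpolyAt u P) ∧
          (u.asIdeal.inertiaDeg (𝓞 F₀) = 2 →
            r.HasFrobCharpolyAt u (P.roots.map fun a ↦ X - C (a ^ 2)).prod)) :
    CompatibleAE (fun v ↦ (Pch v).roots) r := by
  have h₂ : ∀ᶠ u : HeightOneSpectrum (𝓞 K) in cofinite, ∃ P, Ctrl (u.under (𝓞 F₀)) P :=
    (tendsto_under_cofinite (𝓞 F₀)).eventually hcof
  have h₃ : ∀ᶠ u : HeightOneSpectrum (𝓞 K) in cofinite, u.asIdeal.ramificationIdx (𝓞 F₀) = 1 :=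
    eventually_ramificationIdx_eq_one
  show ∀ᶠ u : HeightOneSpectrum (𝓞 K) in cofinite, _
  filter_upwards [hr, h₂, h₃] with u hu hP he
  obtain ⟨hunr, hf1, hf2⟩ := hu (Pch _) (hPch _ hP) he
  refine ⟨hunr, ?_⟩
  rcases inertiaDeg_eq_one_or_two h2 u with hf | hf
  · rw [hf, frobPoly_one, ← eq_prod_roots_of_hasFrobCharpolyAt (hf1 hf)]
    exact hf1 hf
  · rw [hf]
    exact hf2 hf

end Compatible

/-- **Stub S5″ — patching over the CM quadratic extensions of `F₀` split at `T` and above `ℓ`, with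
DESIGNATED control over rational primes (pure Galois theory + Dirichlet).**  Let `F₀` be a number
field, `ℓ` a prime, `m` a rank, `T` a finite set of places of `F₀`, `Ctrl v P` an abstract
"controlled polynomial at `v`" predicate inhabited at all but finitely many `v`, and `Des v` an
abstract "designatable place" predicate.  Suppose that for every admissible `K` (quadratic, totally
complex, involution `cK ≠ 1`, places above `ℓ` unramified over `F₀`, every `t ∈ T` split) and every
place `v₀` of `F₀` there is a continuous semisimple `r_{K,v₀} : Γ_K → GL_m(ℚ̄_ℓ)` with patch control
(as in `stub_patchDescend`) at all but finitely many places of `K`, and — PROVIDED `v₀` is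
designatable and every place of `F₀` over the rational prime of `v₀` splits completely in `K` —
at every place above `v₀`.  Then there is a continuous semisimple `R : Γ_{F₀} → GL_m(ℚ̄_ℓ)`,
unramified with characteristic polynomial `P` at every DESIGNATABLE `v` with `Ctrl v P`.
Proof: as `stub_patchDescend` over the family `F₀(√-D)`, `D ∈ GoodPrime F₀ (8ℓ∏q_t) ∅`, with the
Frobenius datum of a chosen controlled polynomial (`compatibleAE_of_ctrl_chosen`) and, for a
designatable `v` over the rational prime `q`, the member with `8q ∣ D + 1`
(`GoodPrime.exists_dvd_split`), in which every place over `q` splits (`split_above_of_dvd`).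
[cite: Sorensen2020, §1 Lemma 2 and Example] [cite: HarrisLanTaylorThorneRMS2016, proof of Cor. 7.14] -/
theorem stub_patchDescendRat :
    ∀ (F₀ : Type) [Field F₀] [NumberField F₀] (ℓ : ℕ) [Fact ℓ.Prime] (m : ℕ)
      (T : Finset (HeightOneSpectrum (𝓞 F₀)))
      (Ctrl : HeightOneSpectrum (𝓞 F₀) → (PadicAlgCl ℓ)[X] → Prop)
      (Des : HeightOneSpectrum (𝓞 F₀) → Prop),
      (∀ᶠ v : HeightOneSpectrum (𝓞 F₀) in cofinite, ∃ P, Ctrl v P) →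
      (∀ (K : Type) [Field K] [NumberField K] [Algebra F₀ K] (cK : K ≃ₐ[F₀] K),
        (Module.finrank F₀ K = 2 ∧ cK ≠ 1 ∧ IsTotallyComplex K ∧
          (∀ u : HeightOneSpectrum (𝓞 K), ((ℓ : ℕ) : 𝓞 K) ∈ u.asIdeal →
            u.asIdeal.ramificationIdx (𝓞 F₀) = 1) ∧
          (∀ t ∈ T, ∀ u : HeightOneSpectrum (𝓞 K), u.under (𝓞 F₀) = t →
            u.asIdeal.ramificationIdx (𝓞 F₀) = 1 ∧ u.asIdeal.inertiaDeg (𝓞 F₀) = 1)) →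
        ∀ v₀ : HeightOneSpectrum (𝓞 F₀), ∃ r : FramedGaloisRep K (PadicAlgCl ℓ) m,
          r.toGaloisRep.IsSemisimple ∧
          (∀ᶠ u : HeightOneSpectrum (𝓞 K) in cofinite,
            ∀ P : (PadicAlgCl ℓ)[X], Ctrl (u.under (𝓞 F₀)) P → u.asIdeal.ramificationIdx (𝓞 F₀) = 1 →
              r.IsUnramifiedAt u ∧ (u.asIdeal.inertiaDeg (𝓞 F₀) = 1 → r.HasFrobCharpolyAt u P) ∧
                (u.asIdeal.inertiaDeg (𝓞 F₀) = 2 →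
                  r.HasFrobCharpolyAt u (P.roots.map fun a ↦ X - C (a ^ 2)).prod)) ∧
          (Des v₀ →
            (∀ v' : HeightOneSpectrum (𝓞 F₀), v'.asIdeal.under ℤ = v₀.asIdeal.under ℤ →
              ∀ u' : HeightOneSpectrum (𝓞 K), u'.under (𝓞 F₀) = v' →
                u'.asIdeal.ramificationIdx (𝓞 F₀) = 1 ∧ u'.asIdeal.inertiaDeg (𝓞 F₀) = 1) →
            ∀ u : HeightOneSpectrum (𝓞 K), u.under (𝓞 F₀) = v₀ →
              ∀ P : (PadicAlgCl ℓ)[X], Ctrl (u.under (𝓞 F₀)) P →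
                u.asIdeal.ramificationIdx (𝓞 F₀) = 1 →
                r.IsUnramifiedAt u ∧ (u.asIdeal.inertiaDeg (𝓞 F₀) = 1 → r.HasFrobCharpolyAt u P) ∧
                  (u.asIdeal.inertiaDeg (𝓞 F₀) = 2 →
                    r.HasFrobCharpolyAt u (P.roots.map fun a ↦ X - C (a ^ 2)).prod))) →
      ∃ R : FramedGaloisRep F₀ (PadicAlgCl ℓ) m, R.toGaloisRep.IsSemisimple ∧
        ∀ (v : HeightOneSpectrum (𝓞 F₀)) (P : (PadicAlgCl ℓ)[X]), Ctrl v P → Des v →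
          R.IsUnramifiedAt v ∧ R.HasFrobCharpolyAt v P := by
  intro F₀ _ _ ℓ _ m T Ctrl Des hcof hK
  have hℓ : ℓ.Prime := Fact.out
  -- Step 1: the modulus `M = 8ℓ ∏_{t ∈ T} q_t`
  choose q hq hqmem using fun v : HeightOneSpectrum (𝓞 F₀) ↦ exists_prime_natCast_mem v
  obtain ⟨M, hM0, hℓM, hTM⟩ : ∃ M : ℕ, M ≠ 0 ∧ 8 * ℓ ∣ M ∧
      ∀ t ∈ T, ∃ q : ℕ, q.Prime ∧ ((q : ℕ) : 𝓞 F₀) ∈ t.asIdeal ∧ 8 * q ∣ M := by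
    refine ⟨8 * ℓ * ∏ t ∈ T, q t, ?_, Dvd.intro _ rfl, fun t ht ↦ ⟨q t, hq t, hqmem t, ?_⟩⟩
    · exact mul_ne_zero (mul_ne_zero (by norm_num) hℓ.ne_zero)
        (Finset.prod_ne_zero_iff.mpr fun t _ ↦ (hq t).ne_zero)
    · rw [mul_assoc]
      exact mul_dvd_mul_left 8 ((Finset.dvd_prod_of_mem q ht).mul_left ℓ)
  -- Step 2: the representations `r i v₀` over the admissible members `F₀(√-D_i)`
  choose cK hadm using fun i : GoodPrime F₀ M ∅ ↦ admissible_member ℓ T hℓM hTM i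
  choose r hrss hrae hrv using fun (i : GoodPrime F₀ M ∅) (v₀ : HeightOneSpectrum (𝓞 F₀)) ↦
    hK (sqrtNegField F₀ i.1) (cK i) (hadm i) v₀
  -- every place `v` of `F₀` lies in a member in which every place over its rational prime splits
  have hsplit : ∀ v : HeightOneSpectrum (𝓞 F₀), ∃ i : GoodPrime F₀ M ∅,
      (v.asIdeal.primesOver (𝓞 (sqrtNegField F₀ i.1))).ncard = 2 ∧
      ∀ v' : HeightOneSpectrum (𝓞 F₀), v'.asIdeal.under ℤ = v.asIdeal.under ℤ →
        ∀ u' : HeightOneSpectrum (𝓞 (sqrtNegField F₀ i.1)), u'.under (𝓞 F₀) = v' →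
          u'.asIdeal.ramificationIdx (𝓞 F₀) = 1 ∧ u'.asIdeal.inertiaDeg (𝓞 F₀) = 1 := fun v ↦ by
    obtain ⟨i, hqi, hi⟩ := GoodPrime.exists_dvd_split F₀ M ∅ hM0 Set.finite_empty v (8 * q v)
      (mul_ne_zero (by norm_num) (hq v).ne_zero)
    refine ⟨i, by rwa [finrank_sqrtNegField] at hi, fun v' hv' u' hu' ↦ ?_⟩
    exact split_above_of_dvd i (hq v) hqi v' (natCast_mem_of_under_int_eq (hqmem v) hv') u' hu'
  have hef : ∀ (v : HeightOneSpectrum (𝓞 F₀)) (i : GoodPrime F₀ M ∅),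
      (v.asIdeal.primesOver (𝓞 (sqrtNegField F₀ i.1))).ncard = 2 →
      ∀ u : HeightOneSpectrum (𝓞 (sqrtNegField F₀ i.1)), u.under (𝓞 F₀) = v →
        u.asIdeal.ramificationIdx (𝓞 F₀) = 1 ∧ u.asIdeal.inertiaDeg (𝓞 F₀) = 1 :=
    fun v i hi u hu ↦ ramificationIdx_inertiaDeg_eq_one_of_ncard v
      (hi.trans finrank_sqrtNegField.symm) u hu
  -- control of `r i v` above a DESIGNATABLE `v` in the member attached to `v`
  have hctrl : ∀ v : HeightOneSpectrum (𝓞 F₀), Des v → ∃ i : GoodPrime F₀ M ∅,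
      (v.asIdeal.primesOver (𝓞 (sqrtNegField F₀ i.1))).ncard = 2 ∧
      ∀ u : HeightOneSpectrum (𝓞 (sqrtNegField F₀ i.1)), u.under (𝓞 F₀) = v →
        ∀ P, Ctrl v P → (r i v).IsUnramifiedAt u ∧ (r i v).HasFrobCharpolyAt u P := by
    intro v hDes
    obtain ⟨i, hi, hall⟩ := hsplit v
    refine ⟨i, hi, fun u hu P hP ↦ ?_⟩
    obtain ⟨he, hf⟩ := hef v i hi u hu
    obtain ⟨hunr, hf1, -⟩ := hrv i v hDes hall u hu P (by rw [hu]; exact hP) he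
    exact ⟨hunr, hf1 hf⟩
  -- Step 3: a chosen controlled polynomial and its Frobenius datum
  obtain ⟨Pch, hPch⟩ : ∃ Pch : HeightOneSpectrum (𝓞 F₀) → (PadicAlgCl ℓ)[X],
      ∀ v : HeightOneSpectrum (𝓞 F₀), (∃ P, Ctrl v P) → Ctrl v (Pch v) :=
    ⟨fun v ↦ if h : ∃ P, Ctrl v P then h.choose else 0, fun v h ↦ by
      simp only [dif_pos h]; exact h.choose_spec⟩
  -- Step 4: every `r i v₀` is compatible almost everywhere with the datum
  have hcomp : ∀ (i : GoodPrime F₀ M ∅) (v₀ : HeightOneSpectrum (𝓞 F₀)),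
      CompatibleAE (fun v ↦ (Pch v).roots) (r i v₀) := fun i v₀ ↦
    compatibleAE_of_ctrl_chosen finrank_sqrtNegField hcof hPch (hrae i v₀)
  -- Step 5: patch the `ρ i := r i v⋆`
  haveI := SorensenPatching.infinite_heightOneSpectrum F₀
  obtain ⟨vs⟩ := (inferInstance : Nonempty (HeightOneSpectrum (𝓞 F₀)))
  obtain ⟨R, hRss, -, hRT⟩ := GoodPrime.exists_framedGaloisRep_of_compatibleAE (K := F₀)
    (m := M) (B := ∅) hM0 Set.finite_empty (fun v ↦ (Pch v).roots) (fun i ↦ r i vs)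
    (fun i ↦ hrss i vs) (fun i ↦ hcomp i vs) {v | (∃ P, Ctrl v P) ∧ Des v} (by
      rintro v ⟨hP, hDes⟩
      obtain ⟨i, hi, hiv⟩ := hctrl v hDes
      refine ⟨i, hi, fun w hw ↦ ?_⟩
      have hw' : w.under (𝓞 F₀) = v := HeightOneSpectrum.ext hw
      obtain ⟨hunr, hch⟩ := hiv w hw' (Pch v) (hPch v hP)
      obtain ⟨e⟩ := (hcomp i v).nonempty_equiv (hrss i v) (hrss i vs) (hcomp i vs)
      refine ⟨FramedGaloisRep.isUnramifiedAt_of_equiv e hunr, ?_⟩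
      rw [← eq_prod_roots_of_hasFrobCharpolyAt hch]
      exact FramedGaloisRep.hasFrobCharpolyAt_of_equiv e hch)
  -- Step 6: read off at a designatable controlled place (`P = Pch v` by uniqueness above `v`)
  refine ⟨R, hRss, fun v P hP hDes ↦ ?_⟩
  obtain ⟨hunr, hch⟩ := hRT v ⟨⟨P, hP⟩, hDes⟩
  obtain ⟨i, -, hiv⟩ := hctrl v hDes
  obtain ⟨u, hu⟩ := exists_under_eq (K := sqrtNegField F₀ i.1) v
  have hPeq : P = Pch v :=
    hasFrobCharpolyAt_unique (hiv u hu P hP).2 (hiv u hu (Pch v) (hPch v ⟨P, hP⟩)).2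
  have hshape := eq_prod_roots_of_hasFrobCharpolyAt (hiv u hu (Pch v) (hPch v ⟨P, hP⟩)).2
  refine ⟨hunr, ?_⟩
  rw [hPeq, hshape]
  exact hch

end Summit.Langlands.Langlands.Theorems.HostInducedRep.GrsExplicitDescent

end
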